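import Mathlib
import HarnessLib
import Summits.HubbardSuperconductivity.HubbardSuperconductivity.Theorems.KLProgrammeKLRegimeSplitTwoLegSizesMSOfCurveJet
import Summits.HubbardSuperconductivity.HubbardSuperconductivity.Theorems.KLProgrammeSalmhoferCutoffDerivTableRecordV2
import Summits.HubbardSuperconductivity.HubbardSuperconductivity.Theorems.KLProgrammeKLRegimeSplitConsts

/-!
# K3 gen-8-FLOW (stmt-HubbardSuperconductivity-20437 `KLRegimeEngineV17F2`, stub (C)): «(C2)-Z-FIT», the ORDER-5 WORD — the third smallness number `εw`
# of `transportTableL2_mul_le` in closed form (cell gate-hubbard-kl, seat p2 g24)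

The (C) one-call's fifth (C2) row is `2⁵(π⁸/4·2⁴·2³²)·W/63 + 2z₅ ≤ mT 5` with the order-5 frame word
`W = curveExtC (klChi2CauchyTab2 4) G.S 1 + curveExtC (klChi2CauchyTab2 4) Q.S' 1·|U|` (`klChi2CauchyTab2 4 = 65550`), and «(C2)-Z-FIT»
(`transportTableL2_mul_le`, …FlowReadTransportZFit) books its contribution through `εw ≥ Gfr₀·w₅·U₀`, `w₅ := 2⁵(π⁸/4·2⁴·2³²)·W/63`.  Here `w₅` is priced:
`curveExtC 65550 c 1 = 400·65550·5·(2π+1)·c 1 ≤ 2³⁰·c 1` and `2⁵(π⁸/4·2³⁶)/63 ≤ 2⁴⁷`, so `w₅ ≤ 2⁷⁷·(G.S 1 + Q.S' 1·|U|)` and, under the frame door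
`Gfr₀·U₀ ≤ 2⁻¹²⁷` (`gfr_mul_le_of_le_klEngU₀4` at `U₀ ≤ klEngU₀4`), **`εw := 2⁻⁵⁰·(G.S 1 + Q.S' 1·|U|)`** is admissible (`orderFiveWord_mul_le`).
Pure real arithmetic; nothing asserts (C), any stub of 20437, K3 or superconductivity.  References: BGM 2006 §2.4 [cite: BenfattoGiulianiMastropietro2006].
-/

noncomputable section

namespace Summit.HubbardSuperconductivity.HubbardSuperconductivity.Theorems.EngineV8

set_option linter.dupNamespace false -- summit = problem name (single-conjunct summit), D-0017

open Real Finset Summit.HubbardSuperconductivity.HubbardSuperconductivity.Theorems.KLRegimeSplit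

/-- `curveExtC X c 1 = 2000·X·(2π + 1)·c 1` (the `j = 1` row: `(4 + max 1 (0!/(8/5))) = 5`, `Σ_{Icc 1 1} c = c 1`). -/
theorem curveExtC_one (X : ℝ) (c : ℕ → ℝ) : curveExtC X c 1 = 2000 * X * (2 * π + 1) * c 1 := by
  rw [curveExtC_of_ne_zero X c one_ne_zero]
  have hmax : max (1 : ℝ) (((1 - 1).factorial : ℝ) / (8 / 5)) = 1 := by norm_num [Nat.factorial]
  rw [hmax]
  simp [Nat.factorial]
  ring

/-- `curveExtC (klChi2CauchyTab2 4) c 1 ≤ 2³⁰·c 1` for `0 ≤ c 1` (`2000·65550·(2π+1) ≈ 9.55·10⁸ < 2³⁰`). -/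
theorem curveExtC_klChi2CauchyTab2_four_one_le {c : ℕ → ℝ} (hc : 0 ≤ c 1) : curveExtC (klChi2CauchyTab2 4) c 1 ≤ 2 ^ 30 * c 1 := by
  have hX : klChi2CauchyTab2 4 = 65550 := by norm_num [klChi2CauchyTab2]
  rw [hX, curveExtC_one]
  have hπ : π < 3.1416 := Real.pi_lt_d4
  have h1 : 2000 * (65550 : ℝ) * (2 * π + 1) ≤ 2 ^ 30 := by nlinarith
  exact mul_le_mul_of_nonneg_right h1 hc

/-- The order-5 Jackson prefactor: `2⁵·(π⁸/4·2⁴·2³²)/63 ≤ 2⁴⁷` (`π⁸ < 9489`). -/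
theorem orderFive_prefactor_le : 2 ^ 5 * (Real.pi ^ 8 / 4 * 2 ^ 4 * (2 : ℝ) ^ 32) / 63 ≤ 2 ^ 47 := by
  have hπ : π < 3.1416 := Real.pi_lt_d4
  have hπ0 : 0 < π := Real.pi_pos
  have hπ2 : π ^ 2 < 9.87 := by nlinarith
  have h20 : 0 ≤ π ^ 2 := by positivity
  have hπ4 : π ^ 4 < 97.42 := by
    have h := mul_lt_mul'' hπ2 hπ2 h20 h20
    have e : π ^ 4 = π ^ 2 * π ^ 2 := by ring
    rw [e]; linarith
  have h40 : 0 ≤ π ^ 4 := by positivity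
  have hπ8 : π ^ 8 < 9491 := by
    have h := mul_lt_mul'' hπ4 hπ4 h40 h40
    have e : π ^ 8 = π ^ 4 * π ^ 4 := by ring
    rw [e]; linarith
  rw [div_le_iff₀ (by norm_num : (0:ℝ) < 63)]
  nlinarith

/-- **The order-5 word**: `w₅ = 2⁵(π⁸/4·2⁴·2³²)·W/63 ≤ 2⁷⁷·(G.S 1 + Q.S' 1·|U|)` for `G.S ≥ 0`, `Q.S' ≥ 0`. -/
theorem orderFiveWord_le {G : GeoConsts} {Q : EngConsts} (hG : ∀ k, 0 ≤ G.S k) (hQ : ∀ k, 0 ≤ Q.S' k) (U : ℝ) :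
    2 ^ 5 * (Real.pi ^ 8 / 4 * 2 ^ 4 * (2 : ℝ) ^ 32) *
        (curveExtC (klChi2CauchyTab2 4) G.S 1 + curveExtC (klChi2CauchyTab2 4) Q.S' 1 * |U|) / 63 ≤
      2 ^ 77 * (G.S 1 + Q.S' 1 * |U|) := by
  have h1 := curveExtC_klChi2CauchyTab2_four_one_le (c := G.S) (hG 1)
  have h2 := curveExtC_klChi2CauchyTab2_four_one_le (c := Q.S') (hQ 1)
  have hU : 0 ≤ |U| := abs_nonneg U
  have hX0 : (0 : ℝ) ≤ klChi2CauchyTab2 4 := by norm_num [klChi2CauchyTab2]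
  have hW0 : 0 ≤ curveExtC (klChi2CauchyTab2 4) G.S 1 + curveExtC (klChi2CauchyTab2 4) Q.S' 1 * |U| :=
    add_nonneg (curveExtC_nonneg hX0 hG 1) (mul_nonneg (curveExtC_nonneg hX0 hQ 1) hU)
  have hW : curveExtC (klChi2CauchyTab2 4) G.S 1 + curveExtC (klChi2CauchyTab2 4) Q.S' 1 * |U| ≤ 2 ^ 30 * (G.S 1 + Q.S' 1 * |U|) := by
    nlinarith [mul_le_mul_of_nonneg_right h2 hU]
  have hpre := orderFive_prefactor_le
  have hpre0 : 0 ≤ 2 ^ 5 * (Real.pi ^ 8 / 4 * 2 ^ 4 * (2 : ℝ) ^ 32) / 63 := by positivity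
  calc 2 ^ 5 * (Real.pi ^ 8 / 4 * 2 ^ 4 * (2 : ℝ) ^ 32) *
          (curveExtC (klChi2CauchyTab2 4) G.S 1 + curveExtC (klChi2CauchyTab2 4) Q.S' 1 * |U|) / 63
      = (2 ^ 5 * (Real.pi ^ 8 / 4 * 2 ^ 4 * (2 : ℝ) ^ 32) / 63) *
          (curveExtC (klChi2CauchyTab2 4) G.S 1 + curveExtC (klChi2CauchyTab2 4) Q.S' 1 * |U|) := by ring
    _ ≤ 2 ^ 47 * (2 ^ 30 * (G.S 1 + Q.S' 1 * |U|)) := mul_le_mul hpre hW hW0 (by positivity)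
    _ = 2 ^ 77 * (G.S 1 + Q.S' 1 * |U|) := by ring

/-- **`εw` IN CLOSED FORM**: with the frame door `Gfr₀·U₀ ≤ 2⁻¹²⁷` (`gfr_mul_le_of_le_klEngU₀4`):
`Gfr₀·w₅·U₀ ≤ 2⁻⁵⁰·(G.S 1 + Q.S' 1·|U|)` — the third smallness number of `transportTableL2_mul_le`. -/
theorem orderFiveWord_mul_le {G : GeoConsts} {Q : EngConsts} {R : RenConsts} (hG : ∀ k, 0 ≤ G.S k) (hQ : ∀ k, 0 ≤ Q.S' k)
    {U U₀ : ℝ} (hGU : R.Gfr 0 * U₀ ≤ 1 / 2 ^ 127) :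
    R.Gfr 0 * (2 ^ 5 * (Real.pi ^ 8 / 4 * 2 ^ 4 * (2 : ℝ) ^ 32) *
        (curveExtC (klChi2CauchyTab2 4) G.S 1 + curveExtC (klChi2CauchyTab2 4) Q.S' 1 * |U|) / 63) * U₀ ≤
      1 / 2 ^ 50 * (G.S 1 + Q.S' 1 * |U|) := by
  have hw := orderFiveWord_le hG hQ U
  have hS0 : 0 ≤ G.S 1 + Q.S' 1 * |U| := add_nonneg (hG 1) (mul_nonneg (hQ 1) (abs_nonneg U))
  have hX0 : (0 : ℝ) ≤ klChi2CauchyTab2 4 := by norm_num [klChi2CauchyTab2]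
  have hw0 : 0 ≤ 2 ^ 5 * (Real.pi ^ 8 / 4 * 2 ^ 4 * (2 : ℝ) ^ 32) *
      (curveExtC (klChi2CauchyTab2 4) G.S 1 + curveExtC (klChi2CauchyTab2 4) Q.S' 1 * |U|) / 63 := by
    have := add_nonneg (curveExtC_nonneg hX0 hG 1) (mul_nonneg (curveExtC_nonneg hX0 hQ 1) (abs_nonneg U))
    positivity
  calc R.Gfr 0 * (2 ^ 5 * (Real.pi ^ 8 / 4 * 2 ^ 4 * (2 : ℝ) ^ 32) *
          (curveExtC (klChi2CauchyTab2 4) G.S 1 + curveExtC (klChi2CauchyTab2 4) Q.S' 1 * |U|) / 63) * U₀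
      = (R.Gfr 0 * U₀) * (2 ^ 5 * (Real.pi ^ 8 / 4 * 2 ^ 4 * (2 : ℝ) ^ 32) *
          (curveExtC (klChi2CauchyTab2 4) G.S 1 + curveExtC (klChi2CauchyTab2 4) Q.S' 1 * |U|) / 63) := by ring
    _ ≤ (1 / 2 ^ 127) * (2 ^ 77 * (G.S 1 + Q.S' 1 * |U|)) := mul_le_mul hGU hw hw0 (by positivity)
    _ = 1 / 2 ^ 50 * (G.S 1 + Q.S' 1 * |U|) := by ring

end Summit.HubbardSuperconductivity.HubbardSuperconductivity.Theorems.EngineV8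

end
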